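import Literature.AnabelianGeometry.EtaleTheta.TemperedFrobenioidCor38SubPreStepsAutRigid
import HarnessLib

/-!
# [EtTh] Cor. 3.8 proof row C38-L02a `PreservesPreSteps` (F-2809): the images of the FROBENIUS morphisms along
# a pre-step — degree invariance, the Frobenius dichotomy, and Frobenius-equivariance of the failure set

S. Mochizuki, *The étale theta function and its Frobenioid-theoretic manifestations*, Publ. RIMS **45** (2009)
[EtTh], Cor. 3.8, proof, PDF p. 81 l. 2–3 ("by [Mzk17], Theorem 3.4, (ii) … it follows that `Ψ` preserves
pre-steps") [cite: MochizukiEtTh2009, Cor 3.8 p.81]; S. Mochizuki, *The geometry of Frobenioids I*, Kyushu J. Math.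
**62** (2008) [FrdI], §0 p. 17 (irreducible morphisms; "any equivalence of categories manifestly preserves irreducible
morphisms", p. 63), Def. 1.2 (iii) p. 22 (pre-steps), Prop. 2.1 (i) p. 44 (the naive Frobenius functor: "`A ↦ A'`,
`φ ↦ φ'` with `φ' ∘ α_A = α_B ∘ φ`"), Thm. 5.2 (i)–(ii) pp. 100–101 (model Frobenioids, the pure Frobenius morphisms
`(d, id, 0, 0)`) [cite: MochizukiFrdI2008, Prop. 2.1 (i) p.44].

abc-iut cell, block C / F (FACT-proving wave), seat abc-iut-f-128 (gen 15).  PROOF-ONLY file (0 definitions), hand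
#11 for the decision on the bare universal closure of `Cor38Hyp.PreservesPreSteps` (FACT-LIST F-2809; label of
record: conditional / instance forms PROVED / bare ∀-closure UNDECIDED as typed).  On top of abc-iut-f-151's degree
theorem (`Cor38Hyp.isLinear_map_of_isPreStep`: the image of a pre-step is LINEAR) and the irreducibility of the pure
Frobenius morphism `F_p = (p, id, 0, 0)` of prime degree (`TemperedFrobenioid.isIrreducibleHom_powUnitHom`), it
records what an ARBITRARY record `h : Cor38Hyp C₁ C₂` does to the Frobenius morphisms `F_d^X : X → X^{(d)}` sitting
next to a pre-step — with NO hypothesis on `Φ`, `B`, the bases, or partners.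

WHAT IS PROVED (every record `h`, unless a hypothesis is named in the signature).
* §1, model Frobenioids of ANY data with group-like `B` over a totally epimorphic base:
  `ModelFrobenioid.isIso_baseMap_of_isIrreducibleHom_of_degFr_ne_one` — an IRREDUCIBLE arrow of Frobenius degree
  `≠ 1` has an invertible base and a unit zero divisor (it is `F_d ≫ (linear)`, and `F_d` is not invertible).
* §2 (a) **`Cor38Hyp.degFr_map_powUnitHom_eq_of_isPreStep`** — DEGREE INVARIANCE ALONG PRE-STEPS: for a pre-step
  `φ : X → Y` of `C₁` and every `d`, `deg_Fr(Ψ F_d^X) = deg_Fr(Ψ F_d^Y)` (the naturality square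
  `F_d^X ≫ φ^{(d)} = φ ≫ F_d^Y` of [FrdI] Prop. 2.1 (i), whose two pre-step sides have LINEAR images).
* §2 (b) **`Cor38Hyp.frobenius_dichotomy`** — for every object `X` of `C₁` and prime `p`: EITHER
  `deg_Fr(Ψ F_p^X) ≥ 2`, `Base(Ψ F_p^X)` is invertible and `Div(Ψ F_p^X)` is a unit, OR `deg_Fr(Ψ F_p^X) = 1` and
  `Base(Ψ F_p^X)` is NOT invertible (an irreducible arrow of degree `≥ 2` is a pure Frobenius arrow up to isomorphism;
  a linear image over an invertible base would be a pre-step of `C₂` whose `Ψ⁻¹`-image `F_p^X` would be linear by the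
  degree theorem for `Ψ⁻¹`).  By (a) the alternative is CONSTANT along pre-steps.
* §2 (c) **`Cor38Hyp.isPreStep_map_powHom_iff_of_isPreStep`** — FROBENIUS-EQUIVARIANCE OF THE FAILURE SET: in the
  first alternative at `X` (some `p` with `deg_Fr(Ψ F_p^X) ≥ 2`), a pre-step `φ : X → Y` is carried to a pre-step iff
  its `p`-th power `φ^{(p)} = (1, Base φ, p·Div φ, p·u_φ) : X^{(p)} → Y^{(p)}` is (the bases of `Ψ φ` and `Ψ φ^{(p)}`
  are conjugate by the invertible bases of `Ψ F_p^X`, `Ψ F_p^Y`); and **`Cor38Hyp.isPreStep_map_or_frobenius_linear`**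
  — the unconditional trichotomy per prime `p`: `Ψ φ` is a pre-step, or `Ψ φ^{(p)}` is not a pre-step either, or ALL
  Frobenius images `Ψ F_p` along the pre-step component of `X` are linear arrows over non-invertible base arrows.
READING (cell rule R5; FACT-LIST label NOT moved).  For a separating record the set of moved pre-steps of a fibre is
stable under the Frobenius powers `φ ↦ φ^{(p)}` for every prime `p` in the first alternative; a record in the second
alternative for ALL primes sends every pure Frobenius morphism of that pre-step component to a LINEAR arrow over a
non-invertible base arrow of `D₂` (for the object `(A, 0)` these are pairwise commuting non-invertible endomorphisms
`b_p` of one object of `D₂`, non-FSM by [FrdI] §0 p. 18) — the "degree-collapsing" records of the F-2815 census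
(abc-iut-w4-d097's `AffDil`) are of this second kind on non-pre-steps.  Together with hand #10
(`TemperedFrobenioidCor38SubPreStepsChains.lean`: along ω-chains of pre-steps only finitely many images fail) this pins
the shape of any separating record further; no [FrdI] Thm. 3.4 input, no Frobenioid axiom, vocabulary clauses
untouched.  HONEST FRAMING: bookkeeping about OUR typed Def. 3.6 interface (print's Cor. 3.8 quotes [FrdI] Thm. 3.4
(ii) for genuine Frobenioids); proved-as-typed ≠ proved-in-print; nothing here bears on [IUTchIII] Cor. 3.12; no side
taken; a FACT row is an assumption label; typed ≠ proved.
-/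

namespace Literature.AlgebraicGeometry.Frobenioids

open CategoryTheory Opposite

universe w v u

/-! ## §1 Model Frobenioids: irreducible arrows of Frobenius degree `≠ 1` -/

namespace ModelFrobenioid

variable {D : Type u} [Category.{v} D] {Φ B : Dᵒᵖ ⥤ CommMonCat.{w}} {DivB : B ⟶ monoidGp Φ}

/-- **An irreducible arrow of Frobenius degree `d ≠ 1` has an invertible base and a unit zero divisor**: it factors
as `F_d ≫ L` with `L` linear ([FrdI] Def. 1.3 (iv)(a) on the model), `F_d = (d, id, 0, 0)` is not an isomorphism
(its degree is not `1`), so `L` is an isomorphism, and `Base`, `Div` of the composite are those of `L`.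
[cite: MochizukiFrdI2008, §0 p.17] -/
theorem isIso_baseMap_of_isIrreducibleHom_of_degFr_ne_one {X Y : ModelFrobenioid Φ B DivB} (ι : X ⟶ Y)
    (hι : IsIrreducibleHom ι) (hd : degFr ι ≠ 1) : IsIso (baseMap ι) ∧ IsUnit (div ι) := by
  obtain ⟨L, -, hfac⟩ := exists_powUnitHom_comp_eq_of_eq_mul ι (p := degFr ι) (q := 1) (mul_one _).symm
  rcases hι.2 _ L hfac with hLi | hFi
  · haveI := hLi
    refine ⟨?_, ?_⟩
    · have hb : IsIso (baseMap (powUnitHom Φ B DivB (degFr ι) X ≫ L)) := by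
        rw [ModelFrobenioid.baseMap_comp]
        change IsIso (𝟙 X.base ≫ baseMap (X := powObj Φ B DivB (degFr ι) X) (Y := Y) L)
        rw [Category.id_comp]
        change IsIso ((ModelFrobenioid.baseFunctor Φ B DivB).map L)
        infer_instance
      rwa [hfac] at hb
    · have hu : IsUnit (div (powUnitHom Φ B DivB (degFr ι) X ≫ L)) := by
        rw [ModelFrobenioid.div_comp]
        exact IsUnit.mul (IsUnit.map _ (isUnit_div_of_isIso L)) (IsUnit.pow _ isUnit_one)
      rwa [hfac] at hu
  · haveI := hFi
    exact (hd (degFr_eq_one_of_isIso (powUnitHom Φ B DivB (degFr ι) X))).elim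

end ModelFrobenioid

end Literature.AlgebraicGeometry.Frobenioids

/-! ## §2 The Frobenius morphisms next to a pre-step, for every record -/

namespace Literature.AnabelianGeometry.EtaleTheta

open CategoryTheory Opposite Literature.AlgebraicGeometry.Frobenioids
open ModelFrobenioid (powUnitHom powObj powHom degFr baseMap)

universe u₀ v₀ u v w

variable {D₀ : Type u₀} [Category.{v₀} D₀] {V : FrdIMonoidStub.{w}}
  {T : RealifiedDivisorMonoids (D₀ := D₀) V} {D : Type u} [Category.{v} D] {VD : FrdICatStub.{u, v, w} D}

namespace TemperedFrobenioid

/-- The `d`-th power `φ^{(d)} = (deg φ, Base φ, d·Div φ, d·u_φ)` of a pre-step `φ` of a typed tempered Frobenioid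
(the naive Frobenius functor of [FrdI] Prop. 2.1 (i) on the model) is a pre-step: same degree, same base.
[cite: MochizukiFrdI2008, Prop. 2.1 (i) p.44] -/
theorem opsData_isPreStep_powHom (C : TemperedFrobenioid T D VD) (d : ℕ+) {X Y : C.category} (φ : X ⟶ Y)
    (hφ : C.opsData.IsPreStep φ) : C.opsData.IsPreStep (powHom d φ) := by
  obtain ⟨h1, h2⟩ := (C.opsData_isPreStep_iff φ).1 hφ
  exact (C.opsData_isPreStep_iff _).2 ⟨h1, h2⟩

end TemperedFrobenioid

section Rows

variable {D₀' : Type u₀} [Category.{v₀} D₀'] {T' : RealifiedDivisorMonoids (D₀ := D₀') V}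
  {D' : Type u} [Category.{v} D'] {VD' : FrdICatStub.{u, v, w} D'}
  {C₁ : TemperedFrobenioid T D VD} {C₂ : TemperedFrobenioid T' D' VD'}

namespace Cor38Hyp

variable (h : Cor38Hyp C₁ C₂)

/-- **(a) DEGREE INVARIANCE ALONG PRE-STEPS, every record**: for a pre-step `φ : X → Y` of `C₁` and every `d`,
`deg_Fr(Ψ F_d^X) = deg_Fr(Ψ F_d^Y)` — apply `Ψ` to the naturality square `F_d^X ≫ φ^{(d)} = φ ≫ F_d^Y` of the naive
Frobenius functor and use that both `Ψ φ` and `Ψ φ^{(d)}` are linear (abc-iut-f-151). [cite: MochizukiEtTh2009, Cor 3.8 p.81] -/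
theorem degFr_map_powUnitHom_eq_of_isPreStep (d : ℕ+) {X Y : C₁.category} (φ : X ⟶ Y)
    (hφ : C₁.opsData.IsPreStep φ) :
    degFr (h.Ψ.functor.map (powUnitHom C₁.divisorMonoid C₁.ratFnFunctor C₁.divBNatTrans d X)) =
      degFr (h.Ψ.functor.map (powUnitHom C₁.divisorMonoid C₁.ratFnFunctor C₁.divBNatTrans d Y)) := by
  have hsq := congrArg (fun ψ => degFr (h.Ψ.functor.map ψ))
    (ModelFrobenioid.powUnitHom_comp_powHom C₁.divisorMonoid C₁.ratFnFunctor C₁.divBNatTrans d φ)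
  simp only [Functor.map_comp, ModelFrobenioid.degFr_comp] at hsq
  have h1 : degFr (h.Ψ.functor.map φ) = 1 := h.isLinear_map_of_isPreStep φ hφ
  have h2 : degFr (h.Ψ.functor.map (powHom d φ)) = 1 :=
    h.isLinear_map_of_isPreStep _ (C₁.opsData_isPreStep_powHom d φ hφ)
  rwa [h1, h2, one_mul, mul_one] at hsq

/-- The base square behind (a): `Base(Ψ F_d^X) ≫ Base(Ψ φ^{(d)}) = Base(Ψ φ) ≫ Base(Ψ F_d^Y)` in `D₂`.
[cite: MochizukiEtTh2009, Cor 3.8 p.81] -/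
theorem baseMap_map_powUnitHom_comp (d : ℕ+) {X Y : C₁.category} (φ : X ⟶ Y) :
    baseMap (h.Ψ.functor.map (powUnitHom C₁.divisorMonoid C₁.ratFnFunctor C₁.divBNatTrans d X)) ≫
        baseMap (h.Ψ.functor.map (powHom d φ)) =
      baseMap (h.Ψ.functor.map φ) ≫
        baseMap (h.Ψ.functor.map (powUnitHom C₁.divisorMonoid C₁.ratFnFunctor C₁.divBNatTrans d Y)) := by
  have hsq := congrArg (fun ψ => baseMap (h.Ψ.functor.map ψ))
    (ModelFrobenioid.powUnitHom_comp_powHom C₁.divisorMonoid C₁.ratFnFunctor C₁.divBNatTrans d φ)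
  simpa only [Functor.map_comp, ModelFrobenioid.baseMap_comp] using hsq

/-- **(b) THE FROBENIUS DICHOTOMY, every record**: for an object `X` of `C₁` and a prime `p`, EITHER
`deg_Fr(Ψ F_p^X) ≥ 2` with `Base(Ψ F_p^X)` invertible and `Div(Ψ F_p^X)` a unit, OR `deg_Fr(Ψ F_p^X) = 1` with
`Base(Ψ F_p^X)` NOT invertible.  (`Ψ F_p^X` is irreducible; of degree `≥ 2` it is a pure Frobenius arrow followed by an
isomorphism; linear over an invertible base it would be a pre-step of `C₂`, so `Ψ⁻¹(Ψ F_p^X) ≅ F_p^X` would be linear by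
abc-iut-f-151's theorem for `Ψ⁻¹`, but `deg_Fr F_p^X = p`.) [cite: MochizukiEtTh2009, Cor 3.8 p.81] -/
theorem frobenius_dichotomy (X : C₁.category) {p : ℕ+} (hp : (p : ℕ).Prime) :
    (2 ≤ (degFr (h.Ψ.functor.map (powUnitHom C₁.divisorMonoid C₁.ratFnFunctor C₁.divBNatTrans p X)) : ℕ) ∧
        IsIso (baseMap (h.Ψ.functor.map (powUnitHom C₁.divisorMonoid C₁.ratFnFunctor C₁.divBNatTrans p X))) ∧
        IsUnit (ModelFrobenioid.div
          (h.Ψ.functor.map (powUnitHom C₁.divisorMonoid C₁.ratFnFunctor C₁.divBNatTrans p X)))) ∨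
      (degFr (h.Ψ.functor.map (powUnitHom C₁.divisorMonoid C₁.ratFnFunctor C₁.divBNatTrans p X)) = 1 ∧
        ¬ IsIso (baseMap (h.Ψ.functor.map (powUnitHom C₁.divisorMonoid C₁.ratFnFunctor C₁.divBNatTrans p X)))) := by
  set F := powUnitHom C₁.divisorMonoid C₁.ratFnFunctor C₁.divBNatTrans p X with hF
  have hirr : IsIrreducibleHom (h.Ψ.functor.map F) := (C₁.isIrreducibleHom_powUnitHom X hp).map_equivalence h.Ψ
  by_cases hd : degFr (h.Ψ.functor.map F) = 1
  · refine Or.inr ⟨hd, fun hiso => hp.ne_one ?_⟩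
    -- linear over an invertible base: a pre-step of `C₂`, so `Ψ⁻¹` of it is linear; but that is `F_p` up to the unit
    have hpre : C₂.opsData.IsPreStep (h.Ψ.functor.map F) := (C₂.opsData_isPreStep_iff _).2 ⟨hd, hiso⟩
    have hlin : degFr (h.Ψ.inverse.map (h.Ψ.functor.map F)) = 1 := h.isLinear_inverse_map_of_isPreStep _ hpre
    have hnat := congrArg degFr (h.Ψ.unit.naturality F)
    simp only [Functor.id_map, Functor.comp_map, ModelFrobenioid.degFr_comp, hlin,
      ModelFrobenioid.degFr_eq_one_of_isIso, one_mul, mul_one] at hnat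
    -- `hnat : degFr F = 1`
    have hFp : degFr F = p := rfl
    rw [hFp] at hnat
    exact_mod_cast congrArg PNat.val hnat
  · refine Or.inl ⟨?_, ModelFrobenioid.isIso_baseMap_of_isIrreducibleHom_of_degFr_ne_one _ hirr hd⟩
    have h1 : 0 < (degFr (h.Ψ.functor.map F) : ℕ) := (degFr (h.Ψ.functor.map F)).pos
    have hne : ((degFr (h.Ψ.functor.map F) : ℕ)) ≠ 1 := fun h' => hd (PNat.coe_eq_one_iff.mp h')
    omega

/-- (b) transported along a pre-step: for a pre-step `φ : X → Y` of `C₁`, `Base(Ψ F_p^X)` is invertible iff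
`Base(Ψ F_p^Y)` is (the alternative of the dichotomy is decided by the degree, which is invariant by (a)).
[cite: MochizukiEtTh2009, Cor 3.8 p.81] -/
theorem isIso_baseMap_map_powUnitHom_iff_of_isPreStep {X Y : C₁.category} (φ : X ⟶ Y)
    (hφ : C₁.opsData.IsPreStep φ) {p : ℕ+} (hp : (p : ℕ).Prime) :
    IsIso (baseMap (h.Ψ.functor.map (powUnitHom C₁.divisorMonoid C₁.ratFnFunctor C₁.divBNatTrans p X))) ↔
      IsIso (baseMap (h.Ψ.functor.map (powUnitHom C₁.divisorMonoid C₁.ratFnFunctor C₁.divBNatTrans p Y))) := by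
  have hdeg := h.degFr_map_powUnitHom_eq_of_isPreStep p φ hφ
  rcases h.frobenius_dichotomy X hp with ⟨hX2, hXi, -⟩ | ⟨hX1, hXn⟩ <;>
    rcases h.frobenius_dichotomy Y hp with ⟨hY2, hYi, -⟩ | ⟨hY1, hYn⟩
  · exact ⟨fun _ => hYi, fun _ => hXi⟩
  · exfalso; rw [hdeg, hY1] at hX2; exact absurd hX2 (by decide)
  · exfalso; rw [← hdeg, hX1] at hY2; exact absurd hY2 (by decide)
  · exact ⟨fun hx => (hXn hx).elim, fun hy => (hYn hy).elim⟩

/-- **(c) FROBENIUS-EQUIVARIANCE OF THE FAILURE SET, every record**: if `deg_Fr(Ψ F_p^X) ≥ 2` for some prime `p`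
(first alternative of the dichotomy at `X`), then a pre-step `φ : X → Y` of `C₁` is carried to a pre-step of `C₂` iff
its `p`-th power `φ^{(p)} : X^{(p)} → Y^{(p)}` is: by the base square of (a), `Base(Ψ φ^{(p)})` and `Base(Ψ φ)` are
conjugate by the invertible arrows `Base(Ψ F_p^X)`, `Base(Ψ F_p^Y)` (`D₂` totally epimorphic is not even needed).
[cite: MochizukiEtTh2009, Cor 3.8 p.81] -/
theorem isPreStep_map_powHom_iff_of_isPreStep {X Y : C₁.category} (φ : X ⟶ Y)
    (hφ : C₁.opsData.IsPreStep φ) {p : ℕ+} (hp : (p : ℕ).Prime)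
    (hX : 2 ≤ (degFr (h.Ψ.functor.map (powUnitHom C₁.divisorMonoid C₁.ratFnFunctor C₁.divBNatTrans p X)) : ℕ)) :
    C₂.opsData.IsPreStep (h.Ψ.functor.map (powHom p φ)) ↔ C₂.opsData.IsPreStep (h.Ψ.functor.map φ) := by
  have hlin : degFr (h.Ψ.functor.map φ) = 1 := h.isLinear_map_of_isPreStep φ hφ
  have hlin' : degFr (h.Ψ.functor.map (powHom p φ)) = 1 :=
    h.isLinear_map_of_isPreStep _ (C₁.opsData_isPreStep_powHom p φ hφ)
  -- both Frobenius images have invertible bases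
  have hXi : IsIso (baseMap (h.Ψ.functor.map
      (powUnitHom C₁.divisorMonoid C₁.ratFnFunctor C₁.divBNatTrans p X))) := by
    rcases h.frobenius_dichotomy X hp with ⟨-, hi, -⟩ | ⟨h1, -⟩
    · exact hi
    · exfalso; rw [h1] at hX; exact absurd hX (by decide)
  have hYi : IsIso (baseMap (h.Ψ.functor.map
      (powUnitHom C₁.divisorMonoid C₁.ratFnFunctor C₁.divBNatTrans p Y))) :=
    (h.isIso_baseMap_map_powUnitHom_iff_of_isPreStep φ hφ hp).1 hXi
  have hsq := h.baseMap_map_powUnitHom_comp p φ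
  rw [C₂.opsData_isPreStep_iff, C₂.opsData_isPreStep_iff]
  refine ⟨fun ⟨_, hb⟩ => ⟨hlin, ?_⟩, fun ⟨_, hb⟩ => ⟨hlin', ?_⟩⟩
  · haveI := hb
    haveI : IsIso (baseMap (h.Ψ.functor.map φ) ≫ baseMap (h.Ψ.functor.map
        (powUnitHom C₁.divisorMonoid C₁.ratFnFunctor C₁.divBNatTrans p Y))) := by
      rw [← hsq]; infer_instance
    exact IsIso.of_isIso_comp_right _ (baseMap (h.Ψ.functor.map
      (powUnitHom C₁.divisorMonoid C₁.ratFnFunctor C₁.divBNatTrans p Y)))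
  · haveI := hb
    haveI : IsIso (baseMap (h.Ψ.functor.map
        (powUnitHom C₁.divisorMonoid C₁.ratFnFunctor C₁.divBNatTrans p X)) ≫
          baseMap (h.Ψ.functor.map (powHom p φ))) := by
      rw [hsq]; infer_instance
    exact IsIso.of_isIso_comp_left (baseMap (h.Ψ.functor.map
      (powUnitHom C₁.divisorMonoid C₁.ratFnFunctor C₁.divBNatTrans p X))) _

/-- **The per-prime trichotomy, every record, no hypothesis**: for a pre-step `φ : X → Y` of `C₁` and a prime
`p`: `Ψ φ` IS a pre-step; or neither `Ψ φ` nor `Ψ φ^{(p)}` is (the moved pre-steps are stable under `p`-th powers);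
or the record is "Frobenius-linear at `p`" on the pre-step component of `X`: `Ψ F_p^X` and `Ψ F_p^Y` are LINEAR arrows
over NON-invertible base arrows of `D₂`. [cite: MochizukiEtTh2009, Cor 3.8 p.81] -/
theorem isPreStep_map_or_frobenius_linear {X Y : C₁.category} (φ : X ⟶ Y) (hφ : C₁.opsData.IsPreStep φ)
    {p : ℕ+} (hp : (p : ℕ).Prime) :
    C₂.opsData.IsPreStep (h.Ψ.functor.map φ) ∨
      (¬ C₂.opsData.IsPreStep (h.Ψ.functor.map φ) ∧ ¬ C₂.opsData.IsPreStep (h.Ψ.functor.map (powHom p φ))) ∨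
      ((degFr (h.Ψ.functor.map (powUnitHom C₁.divisorMonoid C₁.ratFnFunctor C₁.divBNatTrans p X)) = 1 ∧
          ¬ IsIso (baseMap (h.Ψ.functor.map
            (powUnitHom C₁.divisorMonoid C₁.ratFnFunctor C₁.divBNatTrans p X)))) ∧
        (degFr (h.Ψ.functor.map (powUnitHom C₁.divisorMonoid C₁.ratFnFunctor C₁.divBNatTrans p Y)) = 1 ∧
          ¬ IsIso (baseMap (h.Ψ.functor.map
            (powUnitHom C₁.divisorMonoid C₁.ratFnFunctor C₁.divBNatTrans p Y))))) := by
  by_cases hpre : C₂.opsData.IsPreStep (h.Ψ.functor.map φ)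
  · exact Or.inl hpre
  rcases h.frobenius_dichotomy X hp with ⟨hX2, -, -⟩ | hXlin
  · exact Or.inr (Or.inl ⟨hpre, fun hpow => hpre ((h.isPreStep_map_powHom_iff_of_isPreStep φ hφ hp hX2).1 hpow)⟩)
  · refine Or.inr (Or.inr ⟨hXlin, ?_⟩)
    rcases h.frobenius_dichotomy Y hp with ⟨-, hYi, -⟩ | hYlin
    · exact (hXlin.2 ((h.isIso_baseMap_map_powUnitHom_iff_of_isPreStep φ hφ hp).2 hYi)).elim
    · exact hYlin

end Cor38Hyp

end Rows

end Literature.AnabelianGeometry.EtaleTheta
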